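import Mathlib
import Summits.PneNP.PneNP.Theorems.ClusUniversalCertificateCubeB

/-!
# Route ClusUniversalCertificate — the hypercube certificate inequality, III: the block form at `m = 1`

Helper file for `stmt-PneNP-19683` (`Summit.PneNP.PneNP.Theses.ClusUniversalCertificate.UniversalCertAll`,
route-PneNP-ClusUniversalCertificate, rung F-N1; cell pnp-ideate, record
HOME/pnp-ideate-lit/UniversalCertificate.lean + planner p1's Sketch-LiftCap.lean). Part III: the
block-space objects of the route (`Block.U`, `Block.codimIn`, `Block.UniversalCert` — the body of
`UniversalCertAll` at fixed `n, m` — `FlatFamily`, `LiftCapSharp`, `liftCapSharp_of_universal`) and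
the PROVED hypercube case: `universalCert_one : ∀ n, Block.UniversalCert n 1` (transport of `L1Cert`
along `(Fin n → Fin 1 → ZMod 2) ≃ₗ (Fin n → ZMod 2)`), `liftCapSharp_one`, and the same inequality
restated in the literal shape of the route item at `m = 1` (`stub_certificate_m1`, the registered
rung stub of the crux skeleton `birth` on stmt-PneNP-19683). The block case
`m ≥ 2` of `UniversalCertAll` is OPEN; this file is a partial result (`--supports`), not a closer.
[folklore; ROUND-5 §T, KEY-LEMMA.md §0]
-/

set_option linter.dupNamespace false -- `Summit.PneNP.PneNP.…`: summit = sub-problem name (D-0017 single-conjunct layout)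

namespace Summit.PneNP.PneNP.Theorems.ClusCube

open Classical Finset MvPolynomial

noncomputable section

variable {N : ℕ}

namespace Block

/-- The block space: `n` blocks, each `Fin m → ZMod 2` (p1, Sketch-LiftCap.lean, verbatim). -/
abbrev U (n m : ℕ) := Fin n → (Fin m → ZMod 2)

/-- p1's one-sided certificate codimension on the block space (Sketch-LiftCap.lean, verbatim). -/
def codimIn {n m : ℕ} (Y : Finset (U n m)) (y : U n m) : ℕ :=
  sInf {c | ∃ A : AffineSubspace (ZMod 2) (U n m), y ∈ A ∧ (∀ z ∈ A, z ∈ Y) ∧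
    n * m ≤ Module.finrank (ZMod 2) A.direction + c}

/-- p1's `UniversalCert` (R★★_b), verbatim. -/
def UniversalCert (n m : ℕ) : Prop :=
  ∀ Y : Finset (U n m),
    ∑ y ∈ Y, ((n : ℤ) - (codimIn Y y : ℤ)) ≤
      ∑ k : Fin n, (2 : ℤ) ^ m * ((Y.filter fun y => y k = 0).card : ℤ)

/-- A finite family of affine flats of codimension `≤ s` in `U n m` (p1, verbatim). -/
structure FlatFamily (n m s : ℕ) where
  F : ℕ
  N : Fin F → AffineSubspace (ZMod 2) (U n m)
  nonempty : ∀ f, (N f : Set (U n m)).Nonempty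
  codim : ∀ f, n * m ≤ Module.finrank (ZMod 2) (N f).direction + s

/-- The union of the family (p1, verbatim). -/
def FlatFamily.Y {n m s : ℕ} (Φ : FlatFamily n m s) : Finset (U n m) :=
  Finset.univ.filter fun y => ∃ f, y ∈ Φ.N f

/-- The `k`-th zero-section `Y ∩ B_k` (p1, verbatim). -/
def FlatFamily.Ysec {n m s : ℕ} (Φ : FlatFamily n m s) (k : Fin n) : Finset (U n m) :=
  Φ.Y.filter fun y => y k = 0

/-- SHARP LiftCap, abstract form (★): `(n - s)|Y| ≤ Σ_k 2^m |Y ∩ B_k|` (p1, verbatim). -/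
def LiftCapSharp (n m s : ℕ) : Prop :=
  ∀ Φ : FlatFamily n m s, (n - s) * Φ.Y.card ≤ ∑ k : Fin n, 2 ^ m * (Φ.Ysec k).card

/-- A point of a flat of the family has certificate codimension at most `s`. -/
theorem codimIn_le_of_mem {n m s : ℕ} (Φ : FlatFamily n m s) {y : U n m} {f : Fin Φ.F}
    (hy : y ∈ Φ.N f) : codimIn Φ.Y y ≤ s := by
  unfold codimIn
  apply Nat.sInf_le
  refine ⟨Φ.N f, hy, ?_, Φ.codim f⟩
  intro z hz
  simp only [FlatFamily.Y, Finset.mem_filter, Finset.mem_univ, true_and]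
  exact ⟨f, hz⟩

/-- `R★★_b → ★` for every `s` (p1's `liftCapSharp_of_universal`, proof verbatim). -/
theorem liftCapSharp_of_universal (n m : ℕ) (h : UniversalCert n m) (s : ℕ) :
    LiftCapSharp n m s := by
  intro Φ
  have H := h Φ.Y
  have hsec : ∀ k : Fin n, (Φ.Y.filter fun y => y k = 0) = Φ.Ysec k := fun k => rfl
  simp only [hsec] at H
  by_cases hs : n ≤ s
  · have : n - s = 0 := Nat.sub_eq_zero_of_le hs
    simp [this]
  · rw [not_le] at hs
    have hpt : ∀ y ∈ Φ.Y, ((n - s : ℕ) : ℤ) ≤ (n : ℤ) - (codimIn Φ.Y y : ℤ) := by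
      intro y hy
      have hy' : ∃ f, y ∈ Φ.N f := by
        simpa [FlatFamily.Y] using hy
      obtain ⟨f, hf⟩ := hy'
      have hc : codimIn Φ.Y y ≤ s := codimIn_le_of_mem Φ hf
      have : ((n - s : ℕ) : ℤ) = (n : ℤ) - (s : ℤ) := by
        rw [Nat.cast_sub hs.le]
      rw [this]
      have : (codimIn Φ.Y y : ℤ) ≤ (s : ℤ) := by exact_mod_cast hc
      linarith
    have hL : (((n - s) * Φ.Y.card : ℕ) : ℤ) ≤ ∑ y ∈ Φ.Y, ((n : ℤ) - (codimIn Φ.Y y : ℤ)) := by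
      have : (((n - s) * Φ.Y.card : ℕ) : ℤ) = ∑ y ∈ Φ.Y, ((n - s : ℕ) : ℤ) := by
        simp [Finset.sum_const, mul_comm]
      rw [this]
      exact Finset.sum_le_sum hpt
    have hfin := hL.trans H
    exact_mod_cast hfin

end Block

/-- identification of the `m = 1` block space with the hypercube -/
def curry1 (n : ℕ) : Block.U n 1 ≃ₗ[ZMod 2] V n :=
  LinearEquiv.piCongrRight fun _ : Fin n => LinearEquiv.funUnique (Fin 1) (ZMod 2) (ZMod 2)

/-- Unfolding of `curry1`. -/
lemma curry1_apply {n : ℕ} (y : Block.U n 1) (k : Fin n) : curry1 n y k = y k 0 := rfl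

/-- A block of `(𝔽₂¹)ⁿ` vanishes iff the corresponding cube coordinate vanishes. -/
lemma block_zero_iff {n : ℕ} (y : Block.U n 1) (k : Fin n) : y k = 0 ↔ curry1 n y k = 0 := by
  rw [curry1_apply]
  constructor
  · intro h; rw [h]; rfl
  · intro h; funext i; rw [Subsingleton.elim i 0, h]; rfl

/-- **`UniversalCert n 1`** — the hypercube case of p1's universal certificate inequality, hence
(with p1's proved `liftCapSharp_of_universal`) sharp LiftCap for `m = 1`. -/
theorem universalCert_one (n : ℕ) : Block.UniversalCert n 1 := by
  intro Y
  have he : Function.Injective (curry1 n) := (curry1 n).injective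
  set Y' : Finset (V n) := Y.image (curry1 n) with hY'
  -- transport of the certificate codimension
  have hcod : ∀ y ∈ Y, codimIn Y' (curry1 n y) ≤ Block.codimIn Y y := by
    intro y hy
    have hne : {c | ∃ A : AffineSubspace (ZMod 2) (Block.U n 1), y ∈ A ∧ (∀ z ∈ A, z ∈ Y) ∧
        n * 1 ≤ Module.finrank (ZMod 2) A.direction + c}.Nonempty := by
      refine ⟨n * 1, AffineSubspace.mk' y ⊥, AffineSubspace.self_mem_mk' _ _, ?_, by simp⟩
      intro z hz
      rw [AffineSubspace.mem_mk'] at hz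
      have : z = y := by
        rw [Submodule.mem_bot, vsub_eq_sub, sub_eq_zero] at hz
        exact hz
      rw [this]
      exact hy
    have hmem : Block.codimIn Y y ∈ {c | ∃ A : AffineSubspace (ZMod 2) (Block.U n 1),
        y ∈ A ∧ (∀ z ∈ A, z ∈ Y) ∧ n * 1 ≤ Module.finrank (ZMod 2) A.direction + c} :=
      Nat.sInf_mem hne
    obtain ⟨A, hyA, hAY, hdimA⟩ := hmem
    apply Nat.sInf_le
    refine ⟨A.map ((curry1 n : Block.U n 1 →ₗ[ZMod 2] V n).toAffineMap), ?_, ?_, ?_⟩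
    · exact AffineSubspace.mem_map.mpr ⟨y, hyA, rfl⟩
    · intro z hz
      obtain ⟨w, hw, rfl⟩ := AffineSubspace.mem_map.mp hz
      rw [hY']
      exact mem_image_of_mem _ (hAY w hw)
    · rw [AffineSubspace.map_direction, LinearMap.toAffineMap_linear, LinearEquiv.finrank_map_eq]
      simpa using hdimA
  have hL1 := l1Cert_holds n Y'
  have h1 : ∑ y ∈ Y, ((n : ℤ) - (Block.codimIn Y y : ℤ))
      ≤ ∑ y ∈ Y, ((n : ℤ) - (codimIn Y' (curry1 n y) : ℤ)) := by
    refine sum_le_sum fun y hy => ?_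
    have := hcod y hy
    omega
  have h2 : ∑ y ∈ Y, ((n : ℤ) - (codimIn Y' (curry1 n y) : ℤ))
      = (n : ℤ) * Y.card - ∑ y' ∈ Y', (codimIn Y' y' : ℤ) := by
    rw [sum_sub_distrib, sum_const, hY', sum_image (fun a _ b _ h => he h)]
    simp [mul_comm]
  have h3 : ∀ k : Fin n, (Y.card : ℤ) - 2 * ((Y.filter fun y => y k = 0).card : ℤ)
      ≤ |∑ y' ∈ Y', (if y' k = 0 then (1 : ℤ) else -1)| := by
    intro k
    have hs : (∑ y' ∈ Y', (if y' k = 0 then (1 : ℤ) else -1))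
        = ((Y'.filter fun y' => y' k = 0).card : ℤ) - ((Y'.filter fun y' => ¬ y' k = 0).card : ℤ) := by
      rw [Finset.sum_ite, sum_const, sum_const]
      simp
      ring
    have htot : (Y'.filter fun y' => y' k = 0).card + (Y'.filter fun y' => ¬ y' k = 0).card
        = Y'.card := Finset.card_filter_add_card_filter_not _
    have hcardY' : Y'.card = Y.card := by rw [hY', card_image_of_injective _ he]
    have h0 : (Y'.filter fun y' => y' k = 0).card = (Y.filter fun y => y k = 0).card := by
      rw [hY', Finset.filter_image, card_image_of_injective _ he]
      congr 1
      ext y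
      simp only [mem_filter, block_zero_iff]
    rw [hs]
    have := neg_abs_le (((Y'.filter fun y' => y' k = 0).card : ℤ)
      - ((Y'.filter fun y' => ¬ y' k = 0).card : ℤ))
    omega
  have h4 : (n : ℤ) * Y.card - 2 * ∑ k : Fin n, ((Y.filter fun y => y k = 0).card : ℤ)
      ≤ ∑ k : Fin n, |∑ y' ∈ Y', (if y' k = 0 then (1 : ℤ) else -1)| := by
    have := sum_le_sum fun k (_ : k ∈ (univ : Finset (Fin n))) => h3 k
    rw [sum_sub_distrib, sum_const, card_univ, Fintype.card_fin, ← mul_sum] at this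
    simpa using this
  calc ∑ y ∈ Y, ((n : ℤ) - (Block.codimIn Y y : ℤ))
      ≤ (n : ℤ) * Y.card - ∑ y' ∈ Y', (codimIn Y' y' : ℤ) := h1.trans h2.le
    _ ≤ 2 * ∑ k : Fin n, ((Y.filter fun y => y k = 0).card : ℤ) := by linarith [hL1, h4]
    _ = ∑ k : Fin n, (2 : ℤ) ^ 1 * ((Y.filter fun y => y k = 0).card : ℤ) := by
        rw [pow_one, mul_sum]

/-- **Sharp LiftCap in the hypercube (`m = 1`)**: for every finite family of affine flats of
codimension `≤ s` in `(𝔽₂¹)ⁿ`, `(n - s)·|Y| ≤ Σ_k 2·|Y ∩ B_k|`  — p1's `LiftCapSharp n 1 s`. -/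
theorem liftCapSharp_one (n s : ℕ) : Block.LiftCapSharp n 1 s :=
  Block.liftCapSharp_of_universal n 1 (universalCert_one n) s

/-- **The universal block affine-slice certificate at `m = 1`** — the `m = 1` instance of the route
item `UniversalCertAll` (stmt-PneNP-19683) in its literal shape. The general block case is open. -/
theorem stub_certificate_m1 (n : ℕ) (Y : Finset (Fin n → Fin 1 → ZMod 2)) :
    ∑ y ∈ Y, ((n : ℤ) - ((sInf {c : ℕ | ∃ A : AffineSubspace (ZMod 2) (Fin n → Fin 1 → ZMod 2),
      y ∈ A ∧ (∀ z ∈ A, z ∈ Y) ∧ n * 1 ≤ Module.finrank (ZMod 2) A.direction + c} : ℕ) : ℤ)) ≤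
      ∑ k : Fin n, (2 : ℤ) ^ 1 * ((Y.filter fun y => y k = 0).card : ℤ) :=
  universalCert_one n Y

end

end Summit.PneNP.PneNP.Theorems.ClusCube
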